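import Summits.BirchSwinnertonDyer.Rank1Residual.X11a.PrintDischargeKimDeep
import Literature.NumberTheory.EllipticCurves.TateParameterNotPthPowerOfJProofs
import Literature.NumberTheory.EllipticCurves.Kim2026.ShaLengthRankZeroLowerBoundMultiplicative
import HarnessLib

/-!
# Class X11a — the PRINT route's discharge interface: the TATE ROAD to the `(t0)` binder of the deep
# Kurihara door at a SPLIT multiplicative `p` with `p ∣ v_p(Δ_min)` (pair `320045bh1 @ 5`)

Cell `bsd-print-x11a` (D-0131 print tier), seat ty2 (the DISCHARGE INTERFACE); PLAN v6.4 RULING 4,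
T0-TATE (a). THEOREMS ONLY (no definition, no named fact, no `sorry`). Sequel of p1's
`X11a/PrintDischargeKimDeep.lean` (at the 400-line cap; §2 there: the proof-covered Kim twin
`Kim2026.rankZero_le_padicValNat_sha_of_kuriharaNumber_ne_zero_of_localTorsionTrivial` needs the
`(t0)` binder `#E(ℚ_p)[p] = 1`, discharged there only on «non-split or `p ∤ v_p(Δ_min)`»,
`natCard_localPTorsion_eq_one_of_mult`). On X11a («no (ram) prime») a SPLIT `p` typically has
`p ∣ v_p(Δ_min)` (e.g. `320045bh1 @ 5`: split `I₅`), where that disjunction fails; but `E(ℚ_p)[p] ≠ 0 ⟺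
q_E ∈ (ℚ_p^×)^p ⟺ p ∣ v_p(q_E) ∧ u_q^{p−1} ≡ 1 (mod p²)` (Tate + Serre II §3.3), and the unit congruence
is decided by the RATIONAL datum `j(E)⁻¹ = p^k·u`: the Literature companion
`TateParameterNotPthPowerOfJProofs.lean` (this seat, T0-TATE (b)) proves
`natCard_localPTorsion_eq_one_of_split_of_unitCongruence_fails` — UNCONDITIONAL, Tate's uniformisation
being DISCHARGED in the tree (`TateCurve.tateUniformization_points_holds`).

* §1 (c1) `ClassX11a.missingLowerBoundAt_of_kimDeep_of_localTorsionTrivial'` — p1's §2 door with the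
  `(t0)` binder passed RAW (`ht0 : Nat.card {Q // p • Q = 0} = 1`, displayed; lit g8 DOSSIER §38.7 (a));
  `ClassX11a.bsdp_of_kimDeep_of_localTorsionTrivial'` with Wuthrich's Euler half.
* §2 (c2) **`ClassX11a.missingLowerBoundAt_of_kimDeep_of_tate`** — `ht0` DISCHARGED from `hsplit` and the
  three `norm_num`/`decide`-able side conditions `hju : W.j⁻¹ = p^k·u`, `hu : v_p u = 0`,
  `hunit : p⁻² < |u^{p−1} − 1|_p` (for `320045bh1 @ 5`: `k = 5`, `u ≡ 17`, `u⁴ ≡ 21 (mod 25)`);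
  `ClassX11a.bsdp_of_kimDeep_of_tate`. No new named fact ⇒ the same flag-free currency as p1's §2.
* §3 (c3) `ClassX11a.missingLowerBoundAt_of_kimDeep_of_tateCertificate` — §2 with `u = a/b` displayed as
  integers and `p ∤ a`, `p ∤ b`, `p² ∤ a^{p−1} − b^{p−1}` checked by `decide`; `…bsdp_of_kimDeep_of_tateCertificate`.
* §4 (appended, ty1 g3 TURNKEY T-ty1-A) **`ClassX11a.missingLowerBoundAt_of_kimDeep_mult`** — the door
  through ty1's twin `Kim2026.…_of_splitMultiplicative_or_localTorsionTrivial` (Kim's OWN `t`: `t = 0` at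
  every SPLIT multiplicative `p`, AJM 148 §3.2.1 / Lemma 3.9), whose binder «split ∨ `#E(ℚ_p)[p] = 1`» is
  discharged from `Mult` alone (non-split ⟹ `natCard_localPTorsion_eq_one_of_mult`): NO local datum, no
  Tate certificate, every depth `k ≥ 1`; `ClassX11a.bsdp_of_kimDeep_mult`.

Displayed per pair: the four printed facts of p1's door (`hKim0`, `hϖ`, `hGZK`, `hmod` [+ `hWu`]), the
class, `5 ≤ p`, `Surj`, the parametrisation datum `D` with `p ∤ c_D`, the certificate
`(k, n, hcyc, ψ, hψ, hδ)` (ENGINE M), and either `ht0` (§1) or `(hsplit, u, k_j, hju, hu0, hu, hunit)` (§2).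
HONEST FRAMING: per pair (E1 currency); NOT a class theorem; the leaf `ClassX11a` stays open;
beyond-print theorem: no (composition of printed + proved results).

References: [Kim2022StructureSelmer] Thm. 1.9 (6), Prop. 3.1–3.2, Thm. 3.13; [SilvermanATAEC1994]
Thm. V.3.1 (b), (d), V.5.3; [Serre1973] Ch. II §3.3; [Wuthrich2014] Prop. 21; [Miller2011LMS] Def. 1.1;
cell files `pub/bsd-print-x11a/PLAN.md` v6.4, `staging/plan/T0_tate_road.lean`, `DOSSIER.md` §38.7.
-/

set_option autoImplicit false

noncomputable section

open scoped Classical MatrixGroups ModularForm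

open CongruenceSubgroup WeierstrassCurve Literature.NumberTheory.EllipticCurves
  Literature.NumberTheory.EllipticCurves.ModularForms
  Literature.NumberTheory.EllipticCurves.Rank1Residual
  Literature.NumberTheory.EllipticCurves.Rank1Residual.Typed
  Literature.NumberTheory.EllipticCurves.Wuthrich2014

namespace Summit.BirchSwinnertonDyer.Rank1Residual.X11a

variable {W : WeierstrassCurve ℚ} [W.IsElliptic] [W.IsGloballyMinimal] {p : ℕ} [Fact p.Prime]

/-! ### §1 The `(t0)` binder displayed raw -/

/-- **(c1) Deep Kurihara door, `(t0)` binder RAW**: p1's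
`ClassX11a.missingLowerBoundAt_of_kimDeep_of_localTorsionTrivial` with the multiplicative-locus
disjunction replaced by the binder `#E(ℚ_p)[p] = 1` itself (`ht0`, displayed — or discharged by §2).
`L(E,1) ≠ 0` from `r_an = 0` (`hmod`), `Ш` finite (`hGZK`), the period transfer (`hϖ`), then Kim's
proof-covered Thm. 1.8 (6) at depth `k ≤ ord_p ∏c + 1` and the rank-`0` bookkeeping
`Additive.missingLowerBoundAt_of_rankZero_of_LOmegaWitness`. Per pair; NOT a class theorem.
[cite: Kim2022StructureSelmer, Thm. 1.9 (6) (PDF p. 8), Prop. 3.2 (PDF p. 15), Thm. 3.13 (PDF p. 17)]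
[cite: Miller2011LMS, Def. 1.1 (arXiv:1010.2431 p. 3)] -/
theorem _root_.Summit.BirchSwinnertonDyer.Rank1Residual.ClassX11a.missingLowerBoundAt_of_kimDeep_of_localTorsionTrivial'
    (hKim0 : Kim2026.rankZero_le_padicValNat_sha_of_kuriharaNumber_ne_zero_of_localTorsionTrivial)
    (hϖ : realPeriodRat_eq_unit_mul_plusPeriod_of_multiplicative)
    (hGZK : rank_eq_analyticRank_of_analyticRank_le_one) (hmod : hasEntireLFunction_rat)
    (hX : ClassX11a W p) (hp : 5 ≤ p) (hsurj : Surj W p)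
    (ht0 : Nat.card {Q : (W.baseChange ℚ_[p]).toAffine.Point // (p : ℕ) • Q = 0} = 1)
    {N : ℕ} [NeZero N] (D : ModularParametrizationData W N) (hc : ¬ (p : ℤ) ∣ D.maninConstant)
    (k n : ℕ) [NeZero n] (hk : 1 ≤ k) (hkc : k ≤ padicValNat p W.tamagawaProduct + 1)
    (hn : Kato.IsKolyvaginProduct W p k n)
    (hcyc : ∀ (ℓ : ℕ) [Fact ℓ.Prime], ℓ ∣ n →
      Nat.card {P : ((WeierstrassCurve.integralModelInt W).map
          (Int.castRingHom (ZMod ℓ))).toAffine.Point // p • P = 0} ≤ p)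
    (ψ : (ℓ : ℕ) → (ZMod ℓ)ˣ →* Multiplicative (ZMod (p ^ k)))
    (hψ : ∀ ℓ ∈ n.primeFactors, Function.Surjective (ψ ℓ))
    (hδ : kuriharaNumber D.f (p ^ k) n ψ ≠ 0) : MissingLowerBoundAt W p := by
  have hr : W.analyticRank = 0 := hX.1
  have hL : W.entireLFunction 1 ≠ 0 := (W.analyticRank_eq_zero_iff_holds (hmod W)).mp hr
  have hfin : Finite W.sha := (hGZK W (by rw [hr]; exact zero_le_one)).2
  have hper : ∃ u : ℚ, ‖(u : ℚ_[p])‖ = 1 ∧ W.realPeriodRat = u * plusPeriod D.f :=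
    hϖ W p hp hX.2.2.1 hX.2.2.2.1 D.f D.isNewformOf
  obtain ⟨q, hq, hval⟩ := hKim0 W p hp hsurj ht0 hL hfin D hc hper k n hk hn hcyc ψ hψ hδ
  refine Additive.missingLowerBoundAt_of_rankZero_of_LOmegaWitness W p hGZK hmod hr hX.2.2.2.1 hq
    (j := k - 1) (by omega) ?_
  linarith

/-- **(c1) + Wuthrich's Euler half: `BSD(E,p)`** per pair (`bsdp_iff_missingLowerBoundAt_of_surj`).
NOT a class theorem. [cite: Wuthrich2014, Prop. 21 (p. 400)]
[cite: Kim2022StructureSelmer, Thm. 1.9 (6) (PDF p. 8), Prop. 3.2, Thm. 3.13] [cite: Miller2011LMS, Def. 1.1] -/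
theorem _root_.Summit.BirchSwinnertonDyer.Rank1Residual.ClassX11a.bsdp_of_kimDeep_of_localTorsionTrivial'
    (hWu : sha_dvd_analyticSha)
    (hKim0 : Kim2026.rankZero_le_padicValNat_sha_of_kuriharaNumber_ne_zero_of_localTorsionTrivial)
    (hϖ : realPeriodRat_eq_unit_mul_plusPeriod_of_multiplicative)
    (hGZK : rank_eq_analyticRank_of_analyticRank_le_one) (hmod : hasEntireLFunction_rat)
    (hX : ClassX11a W p) (hp : 5 ≤ p) (hsurj : Surj W p)
    (ht0 : Nat.card {Q : (W.baseChange ℚ_[p]).toAffine.Point // (p : ℕ) • Q = 0} = 1)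
    {N : ℕ} [NeZero N] (D : ModularParametrizationData W N) (hc : ¬ (p : ℤ) ∣ D.maninConstant)
    (k n : ℕ) [NeZero n] (hk : 1 ≤ k) (hkc : k ≤ padicValNat p W.tamagawaProduct + 1)
    (hn : Kato.IsKolyvaginProduct W p k n)
    (hcyc : ∀ (ℓ : ℕ) [Fact ℓ.Prime], ℓ ∣ n →
      Nat.card {P : ((WeierstrassCurve.integralModelInt W).map
          (Int.castRingHom (ZMod ℓ))).toAffine.Point // p • P = 0} ≤ p)
    (ψ : (ℓ : ℕ) → (ZMod ℓ)ˣ →* Multiplicative (ZMod (p ^ k)))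
    (hψ : ∀ ℓ ∈ n.primeFactors, Function.Surjective (ψ ℓ))
    (hδ : kuriharaNumber D.f (p ^ k) n ψ ≠ 0) : BSDp W p :=
  (bsdp_iff_missingLowerBoundAt_of_surj hWu hGZK hmod hX hsurj).2
    (hX.missingLowerBoundAt_of_kimDeep_of_localTorsionTrivial' hKim0 hϖ hGZK hmod hp hsurj ht0 D hc k n
      hk hkc hn hcyc ψ hψ hδ)

/-! ### §2 The Tate road: `(t0)` from the rational datum `j⁻¹ = p^k·u` at a split `p` -/

/-- **(c2) Deep Kurihara door on the SPLIT locus, `(t0)` by the TATE ROAD**: at a split multiplicative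
`p ≥ 5`, `#E(ℚ_p)[p] = 1` is DECIDED by `j(W)⁻¹ = p^k·u`, `u ≠ 0`, `v_p(u) = 0` and the failed unit
congruence `p⁻² < |u^{p−1} − 1|_p` (`natCard_localPTorsion_eq_one_of_split_of_unitCongruence_fails`:
Tate `E(ℚ_p) ≅ ℚ_p^×/q^ℤ` — tree theorem `tateUniformization_points_holds` — and Serre II §3.3), so §1's
door needs no displayed `(t0)` binder. For `320045bh1 @ 5`: `j⁻¹ = 5⁵·u`, `u = −1/906618735030272`,
`u ≡ 17`, `u⁴ ≡ 21 ≢ 1 (mod 25)` (lit g8 DOSSIER §38.7). Per pair; NOT a class theorem; no new named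
fact. [cite: Kim2022StructureSelmer, Thm. 1.9 (6) (PDF p. 8), Prop. 3.1–3.2, Thm. 3.13]
[cite: SilvermanATAEC1994, Thm. V.3.1 (b), (d) and Thm. V.5.3] [cite: Serre1973, Ch. II §3.3]
[cite: Miller2011LMS, Def. 1.1] -/
theorem _root_.Summit.BirchSwinnertonDyer.Rank1Residual.ClassX11a.missingLowerBoundAt_of_kimDeep_of_tate
    (hKim0 : Kim2026.rankZero_le_padicValNat_sha_of_kuriharaNumber_ne_zero_of_localTorsionTrivial)
    (hϖ : realPeriodRat_eq_unit_mul_plusPeriod_of_multiplicative)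
    (hGZK : rank_eq_analyticRank_of_analyticRank_le_one) (hmod : hasEntireLFunction_rat)
    (hX : ClassX11a W p) (hp : 5 ≤ p) (hsurj : Surj W p)
    (hsplit : W.HasSplitMultiplicativeReductionAtPrime p)
    {u : ℚ} {kj : ℕ} (hju : W.j⁻¹ = (p : ℚ) ^ kj * u) (hu0 : u ≠ 0) (hu : padicValRat p u = 0)
    (hunit : (p : ℚ) ^ (-2 : ℤ) < padicNorm p (u ^ (p - 1) - 1))
    {N : ℕ} [NeZero N] (D : ModularParametrizationData W N) (hc : ¬ (p : ℤ) ∣ D.maninConstant)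
    (k n : ℕ) [NeZero n] (hk : 1 ≤ k) (hkc : k ≤ padicValNat p W.tamagawaProduct + 1)
    (hn : Kato.IsKolyvaginProduct W p k n)
    (hcyc : ∀ (ℓ : ℕ) [Fact ℓ.Prime], ℓ ∣ n →
      Nat.card {P : ((WeierstrassCurve.integralModelInt W).map
          (Int.castRingHom (ZMod ℓ))).toAffine.Point // p • P = 0} ≤ p)
    (ψ : (ℓ : ℕ) → (ZMod ℓ)ˣ →* Multiplicative (ZMod (p ^ k)))
    (hψ : ∀ ℓ ∈ n.primeFactors, Function.Surjective (ψ ℓ))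
    (hδ : kuriharaNumber D.f (p ^ k) n ψ ≠ 0) : MissingLowerBoundAt W p :=
  hX.missingLowerBoundAt_of_kimDeep_of_localTorsionTrivial' hKim0 hϖ hGZK hmod hp hsurj
    (natCard_localPTorsion_eq_one_of_split_of_unitCongruence_fails (by omega) W hsplit hju hu0 hu hunit)
    D hc k n hk hkc hn hcyc ψ hψ hδ

/-- **(c2) + Wuthrich's Euler half: `BSD(E,p)` by the Tate road** per pair. NOT a class theorem.
[cite: Wuthrich2014, Prop. 21 (p. 400)] [cite: Kim2022StructureSelmer, Thm. 1.9 (6) (PDF p. 8), Prop. 3.1–3.2, Thm. 3.13]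
[cite: SilvermanATAEC1994, Thm. V.3.1 (b), (d) and Thm. V.5.3] [cite: Miller2011LMS, Def. 1.1] -/
theorem _root_.Summit.BirchSwinnertonDyer.Rank1Residual.ClassX11a.bsdp_of_kimDeep_of_tate
    (hWu : sha_dvd_analyticSha)
    (hKim0 : Kim2026.rankZero_le_padicValNat_sha_of_kuriharaNumber_ne_zero_of_localTorsionTrivial)
    (hϖ : realPeriodRat_eq_unit_mul_plusPeriod_of_multiplicative)
    (hGZK : rank_eq_analyticRank_of_analyticRank_le_one) (hmod : hasEntireLFunction_rat)
    (hX : ClassX11a W p) (hp : 5 ≤ p) (hsurj : Surj W p)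
    (hsplit : W.HasSplitMultiplicativeReductionAtPrime p)
    {u : ℚ} {kj : ℕ} (hju : W.j⁻¹ = (p : ℚ) ^ kj * u) (hu0 : u ≠ 0) (hu : padicValRat p u = 0)
    (hunit : (p : ℚ) ^ (-2 : ℤ) < padicNorm p (u ^ (p - 1) - 1))
    {N : ℕ} [NeZero N] (D : ModularParametrizationData W N) (hc : ¬ (p : ℤ) ∣ D.maninConstant)
    (k n : ℕ) [NeZero n] (hk : 1 ≤ k) (hkc : k ≤ padicValNat p W.tamagawaProduct + 1)
    (hn : Kato.IsKolyvaginProduct W p k n)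
    (hcyc : ∀ (ℓ : ℕ) [Fact ℓ.Prime], ℓ ∣ n →
      Nat.card {P : ((WeierstrassCurve.integralModelInt W).map
          (Int.castRingHom (ZMod ℓ))).toAffine.Point // p • P = 0} ≤ p)
    (ψ : (ℓ : ℕ) → (ZMod ℓ)ˣ →* Multiplicative (ZMod (p ^ k)))
    (hψ : ∀ ℓ ∈ n.primeFactors, Function.Surjective (ψ ℓ))
    (hδ : kuriharaNumber D.f (p ^ k) n ψ ≠ 0) : BSDp W p :=
  (bsdp_iff_missingLowerBoundAt_of_surj hWu hGZK hmod hX hsurj).2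
    (hX.missingLowerBoundAt_of_kimDeep_of_tate hKim0 hϖ hGZK hmod hp hsurj hsplit hju hu0 hu hunit D hc
      k n hk hkc hn hcyc ψ hψ hδ)

/-! ### §3 The Tate road, INTEGER CERTIFICATE form (what a record displays and `decide` checks) -/

/-- **(c3) Deep Kurihara door on the SPLIT locus, `(t0)` by an integer Tate certificate**: §2 with the
unit `u = a/b` displayed as two integers and the three side conditions in `decide`-able form
`p ∤ a`, `p ∤ b`, `p² ∤ a^{p−1} − b^{p−1}` (`natCard_localPTorsion_eq_one_of_split_of_intCertificate`).
For `320045bh1 @ 5`: `j⁻¹ = 5⁵·(−1)/906618735030272`, `b ≡ 22`, `a⁴ − b⁴ ≡ 1 − 6 = −5 ≢ 0 (mod 25)`.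
Per pair; NOT a class theorem; no new named fact.
[cite: Kim2022StructureSelmer, Thm. 1.9 (6) (PDF p. 8), Prop. 3.1–3.2, Thm. 3.13]
[cite: SilvermanATAEC1994, Thm. V.3.1 (b), (d) and Thm. V.5.3] [cite: Serre1973, Ch. II §3.3]
[cite: Miller2011LMS, Def. 1.1] -/
theorem _root_.Summit.BirchSwinnertonDyer.Rank1Residual.ClassX11a.missingLowerBoundAt_of_kimDeep_of_tateCertificate
    (hKim0 : Kim2026.rankZero_le_padicValNat_sha_of_kuriharaNumber_ne_zero_of_localTorsionTrivial)
    (hϖ : realPeriodRat_eq_unit_mul_plusPeriod_of_multiplicative)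
    (hGZK : rank_eq_analyticRank_of_analyticRank_le_one) (hmod : hasEntireLFunction_rat)
    (hX : ClassX11a W p) (hp : 5 ≤ p) (hsurj : Surj W p)
    (hsplit : W.HasSplitMultiplicativeReductionAtPrime p)
    {a b : ℤ} {kj : ℕ} (hju : W.j⁻¹ = (p : ℚ) ^ kj * ((a : ℚ) / (b : ℚ))) (ha : ¬ (p : ℤ) ∣ a)
    (hb : ¬ (p : ℤ) ∣ b) (hunit : ¬ (p : ℤ) ^ 2 ∣ a ^ (p - 1) - b ^ (p - 1))
    {N : ℕ} [NeZero N] (D : ModularParametrizationData W N) (hc : ¬ (p : ℤ) ∣ D.maninConstant)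
    (k n : ℕ) [NeZero n] (hk : 1 ≤ k) (hkc : k ≤ padicValNat p W.tamagawaProduct + 1)
    (hn : Kato.IsKolyvaginProduct W p k n)
    (hcyc : ∀ (ℓ : ℕ) [Fact ℓ.Prime], ℓ ∣ n →
      Nat.card {P : ((WeierstrassCurve.integralModelInt W).map
          (Int.castRingHom (ZMod ℓ))).toAffine.Point // p • P = 0} ≤ p)
    (ψ : (ℓ : ℕ) → (ZMod ℓ)ˣ →* Multiplicative (ZMod (p ^ k)))
    (hψ : ∀ ℓ ∈ n.primeFactors, Function.Surjective (ψ ℓ))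
    (hδ : kuriharaNumber D.f (p ^ k) n ψ ≠ 0) : MissingLowerBoundAt W p :=
  hX.missingLowerBoundAt_of_kimDeep_of_localTorsionTrivial' hKim0 hϖ hGZK hmod hp hsurj
    (natCard_localPTorsion_eq_one_of_split_of_intCertificate (by omega) W hsplit hju ha hb hunit)
    D hc k n hk hkc hn hcyc ψ hψ hδ

/-- **(c3) + Wuthrich's Euler half: `BSD(E,p)` by an integer Tate certificate** per pair. NOT a class
theorem. [cite: Wuthrich2014, Prop. 21 (p. 400)] [cite: Kim2022StructureSelmer, Thm. 1.9 (6) (PDF p. 8), Prop. 3.1–3.2, Thm. 3.13]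
[cite: SilvermanATAEC1994, Thm. V.3.1 (b), (d) and Thm. V.5.3] [cite: Miller2011LMS, Def. 1.1] -/
theorem _root_.Summit.BirchSwinnertonDyer.Rank1Residual.ClassX11a.bsdp_of_kimDeep_of_tateCertificate
    (hWu : sha_dvd_analyticSha)
    (hKim0 : Kim2026.rankZero_le_padicValNat_sha_of_kuriharaNumber_ne_zero_of_localTorsionTrivial)
    (hϖ : realPeriodRat_eq_unit_mul_plusPeriod_of_multiplicative)
    (hGZK : rank_eq_analyticRank_of_analyticRank_le_one) (hmod : hasEntireLFunction_rat)
    (hX : ClassX11a W p) (hp : 5 ≤ p) (hsurj : Surj W p)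
    (hsplit : W.HasSplitMultiplicativeReductionAtPrime p)
    {a b : ℤ} {kj : ℕ} (hju : W.j⁻¹ = (p : ℚ) ^ kj * ((a : ℚ) / (b : ℚ))) (ha : ¬ (p : ℤ) ∣ a)
    (hb : ¬ (p : ℤ) ∣ b) (hunit : ¬ (p : ℤ) ^ 2 ∣ a ^ (p - 1) - b ^ (p - 1))
    {N : ℕ} [NeZero N] (D : ModularParametrizationData W N) (hc : ¬ (p : ℤ) ∣ D.maninConstant)
    (k n : ℕ) [NeZero n] (hk : 1 ≤ k) (hkc : k ≤ padicValNat p W.tamagawaProduct + 1)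
    (hn : Kato.IsKolyvaginProduct W p k n)
    (hcyc : ∀ (ℓ : ℕ) [Fact ℓ.Prime], ℓ ∣ n →
      Nat.card {P : ((WeierstrassCurve.integralModelInt W).map
          (Int.castRingHom (ZMod ℓ))).toAffine.Point // p • P = 0} ≤ p)
    (ψ : (ℓ : ℕ) → (ZMod ℓ)ˣ →* Multiplicative (ZMod (p ^ k)))
    (hψ : ∀ ℓ ∈ n.primeFactors, Function.Surjective (ψ ℓ))
    (hδ : kuriharaNumber D.f (p ^ k) n ψ ≠ 0) : BSDp W p :=
  (bsdp_iff_missingLowerBoundAt_of_surj hWu hGZK hmod hX hsurj).2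
    (hX.missingLowerBoundAt_of_kimDeep_of_tateCertificate hKim0 hϖ hGZK hmod hp hsurj hsplit hju ha hb
      hunit D hc k n hk hkc hn hcyc ψ hψ hδ)

/-! ### §4 Kim's own `t = 0` on the multiplicative locus: the door with NO local datum (T-ty1-A) -/

/-- **Deep Kurihara door on the WHOLE multiplicative locus, no local datum** (ty1 g3 TURNKEY T-ty1-A):
Kim's `t` is `0` at every split multiplicative `p` BY DEFINITION (AJM 148 §3.2.1, Lemma 3.9: the
`exp*` computation at a multiplicative `p ≥ 3` carries no torsion term), so the printed deep-level
argument (Thm. 3.13, `x_n = u·p^t·δ̃_n`) covers every depth `k ≥ 1` there; ty1's twin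
`Kim2026.rankZero_le_padicValNat_sha_of_kuriharaNumber_ne_zero_of_splitMultiplicative_or_localTorsionTrivial`
carries the binder «`W` split at `p` ∨ `#E(ℚ_p)[p] = 1`», which `Mult W p` discharges in the kernel:
split ⟹ `inl`; non-split ⟹ `E(ℚ_p)[p] = 0` (`natCard_localPTorsion_eq_one_of_mult`). Same displayed
binders as p1's literal door `ClassX11a.missingLowerBoundAt_of_kimDeep`; supersedes §1–§3 for bookings
(the Tate road stays as unconditional mathematics about `E(ℚ_p)[p]`). Per pair; NOT a class theorem.
[cite: Kim2022StructureSelmer, §3.2.1 (PDF p. 15), Lemma 3.9 (PDF p. 16), Thm. 3.13 (PDF p. 17), Thm. 1.9 (6) (PDF p. 8)]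
[cite: SilvermanAEC2009, Thm. VII.6.1 and Exercise 3.5] [cite: Miller2011LMS, Def. 1.1] -/
theorem _root_.Summit.BirchSwinnertonDyer.Rank1Residual.ClassX11a.missingLowerBoundAt_of_kimDeep_mult
    (hKimM : Kim2026.rankZero_le_padicValNat_sha_of_kuriharaNumber_ne_zero_of_splitMultiplicative_or_localTorsionTrivial)
    (hϖ : realPeriodRat_eq_unit_mul_plusPeriod_of_multiplicative)
    (hGZK : rank_eq_analyticRank_of_analyticRank_le_one) (hmod : hasEntireLFunction_rat)
    (hX : ClassX11a W p) (hp : 5 ≤ p) (hsurj : Surj W p)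
    {N : ℕ} [NeZero N] (D : ModularParametrizationData W N) (hc : ¬ (p : ℤ) ∣ D.maninConstant)
    (k n : ℕ) [NeZero n] (hk : 1 ≤ k) (hkc : k ≤ padicValNat p W.tamagawaProduct + 1)
    (hn : Kato.IsKolyvaginProduct W p k n)
    (hcyc : ∀ (ℓ : ℕ) [Fact ℓ.Prime], ℓ ∣ n →
      Nat.card {P : ((WeierstrassCurve.integralModelInt W).map
          (Int.castRingHom (ZMod ℓ))).toAffine.Point // p • P = 0} ≤ p)
    (ψ : (ℓ : ℕ) → (ZMod ℓ)ˣ →* Multiplicative (ZMod (p ^ k)))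
    (hψ : ∀ ℓ ∈ n.primeFactors, Function.Surjective (ψ ℓ))
    (hδ : kuriharaNumber D.f (p ^ k) n ψ ≠ 0) : MissingLowerBoundAt W p := by
  have hr : W.analyticRank = 0 := hX.1
  have hL : W.entireLFunction 1 ≠ 0 := (W.analyticRank_eq_zero_iff_holds (hmod W)).mp hr
  have hfin : Finite W.sha := (hGZK W (by rw [hr]; exact zero_le_one)).2
  have hper : ∃ u : ℚ, ‖(u : ℚ_[p])‖ = 1 ∧ W.realPeriodRat = u * plusPeriod D.f :=
    hϖ W p hp hX.2.2.1 hX.2.2.2.1 D.f D.isNewformOf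
  have ht : W.HasSplitMultiplicativeReductionAtPrime p ∨
      Nat.card {Q : (W.baseChange ℚ_[p]).toAffine.Point // (p : ℕ) • Q = 0} = 1 := by
    by_cases hsplit : W.HasSplitMultiplicativeReductionAtPrime p
    · exact Or.inl hsplit
    · exact Or.inr (natCard_localPTorsion_eq_one_of_mult W p (by omega) hX.2.2.1 (Or.inl hsplit))
  obtain ⟨q, hq, hval⟩ := hKimM W p hp hsurj ht hL hfin D hc hper k n hk hn hcyc ψ hψ hδ
  refine Additive.missingLowerBoundAt_of_rankZero_of_LOmegaWitness W p hGZK hmod hr hX.2.2.2.1 hq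
    (j := k - 1) (by omega) ?_
  linarith

/-- **§4 + Wuthrich's Euler half: `BSD(E,p)`** per pair, no local datum. NOT a class theorem.
[cite: Wuthrich2014, Prop. 21 (p. 400)] [cite: Kim2022StructureSelmer, §3.2.1, Lemma 3.9, Thm. 3.13, Thm. 1.9 (6)]
[cite: Miller2011LMS, Def. 1.1] -/
theorem _root_.Summit.BirchSwinnertonDyer.Rank1Residual.ClassX11a.bsdp_of_kimDeep_mult
    (hWu : sha_dvd_analyticSha)
    (hKimM : Kim2026.rankZero_le_padicValNat_sha_of_kuriharaNumber_ne_zero_of_splitMultiplicative_or_localTorsionTrivial)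
    (hϖ : realPeriodRat_eq_unit_mul_plusPeriod_of_multiplicative)
    (hGZK : rank_eq_analyticRank_of_analyticRank_le_one) (hmod : hasEntireLFunction_rat)
    (hX : ClassX11a W p) (hp : 5 ≤ p) (hsurj : Surj W p)
    {N : ℕ} [NeZero N] (D : ModularParametrizationData W N) (hc : ¬ (p : ℤ) ∣ D.maninConstant)
    (k n : ℕ) [NeZero n] (hk : 1 ≤ k) (hkc : k ≤ padicValNat p W.tamagawaProduct + 1)
    (hn : Kato.IsKolyvaginProduct W p k n)
    (hcyc : ∀ (ℓ : ℕ) [Fact ℓ.Prime], ℓ ∣ n →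
      Nat.card {P : ((WeierstrassCurve.integralModelInt W).map
          (Int.castRingHom (ZMod ℓ))).toAffine.Point // p • P = 0} ≤ p)
    (ψ : (ℓ : ℕ) → (ZMod ℓ)ˣ →* Multiplicative (ZMod (p ^ k)))
    (hψ : ∀ ℓ ∈ n.primeFactors, Function.Surjective (ψ ℓ))
    (hδ : kuriharaNumber D.f (p ^ k) n ψ ≠ 0) : BSDp W p :=
  (bsdp_iff_missingLowerBoundAt_of_surj hWu hGZK hmod hX hsurj).2
    (hX.missingLowerBoundAt_of_kimDeep_mult hKimM hϖ hGZK hmod hp hsurj D hc k n hk hkc hn hcyc ψ hψ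
      hδ)

end Summit.BirchSwinnertonDyer.Rank1Residual.X11a

end
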